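import Literature.NumberTheory.Sieve.QuadraticRootsPrimeModuliDFI
import Literature.NumberTheory.Sieve.QuadraticRootsPrimeModuliDFIHeegnerSum
import Literature.NumberTheory.Sieve.QuadraticRootsPrimeModuliDFIPoincareNormBound
import Literature.NumberTheory.Sieve.QuadraticRootsPrimeModuliDFISobolev
import Literature.NumberTheory.Sieve.QuadraticRootsPrimeModuliDFICaccioppoli
import Literature.NumberTheory.Sieve.QuadraticRootsPrimeModuliDFIFolding
import Literature.NumberTheory.Sieve.QuadraticRootsPrimeModuliDFIKernel
import Literature.NumberTheory.Automorphic.InvariantOperatorRegularity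
import HarnessLib

/-!
# Proof of DFI 1995, Proposition 4 (`dukeFriedlanderIwaniec1995_proposition4_holds`)

Topic `Literature/NumberTheory/Sieve`.  W. Duke, J. B. Friedlander, H. Iwaniec, *Equidistribution
of roots of a quadratic congruence to prime moduli*, Ann. of Math. 141 (1995), Proposition 4
(p. 432): for `f = ax² + 2bx + c` with `D = ac − b² > 0`, `G` smooth supported in `[N, 2N]` with
`|G^{(j)}| ≤ N^{-j}` (`j ≤ 4`) and `h ≪ N`,
`∑_{n ≡ 0 (d)} ρ_h(n) G(n) ≪ τ(d) N^{1/2} [1 + τ(hd)(h,d)^{1/2} d⁻¹ N^{1/2}]^{1/2} log 2N`,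
the implied constant depending on `f` (and the constant in `h ≪ N`).

The paper derives this from (14) (Heegner points and a Poincaré series on `Γ₀(ad)`) and the
spectrally proved Proposition 3.  This file assembles the tree's *spectral-theory-free* proof:

* (14): `RootForms.norm_weylSum_le_card_mul`, `RootForms.exists_card_orbitReps_le`
  (`QuadraticRootsPrimeModuliDFIHeegnerSum`);
* the pointwise bound `|P(z)|² ≤ C_f (‖P‖² + ‖ΔP‖²)_{L²(Γ₀(q)∖ℍ)}`, uniform in `q` (Part A of
  this file: `exists_euclidean_local_bound`, `exists_pointwise_bound`, from the planar Sobolev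
  inequality `…DFISobolev`, Caccioppoli `…DFICaccioppoli` and folding `…DFIFolding`);
* `ΔP_ψ = P_{Δψ}` and the explicit profile of `Δψ` (`…DFIPoincare`, `…DFIKernel`);
* the `L²`-bounds for `P_ψ`, `P_{Δψ}` by unfolding, Weil's bound for Kloosterman sums and the
  divisor-sum bookkeeping (`…DFIPoincareNormBound`, `…DFIDivisorSums`).

## References

* W. Duke, J. B. Friedlander, H. Iwaniec, Ann. of Math. (2) 141 (1995), 423–441, Prop. 3–4,
  (14) p. 428, §4 p. 432. [cite: DukeFriedlanderIwaniec1995, Proposition 4 p. 432]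
* H. Iwaniec, *Spectral Methods of Automorphic Forms*, GSM 53 (2002), §3.2.
  [cite: Iwaniec2002, §3.2]
-/

noncomputable section

namespace Literature.NumberTheory.Sieve

open _root_.MeasureTheory _root_.Set _root_.Filter _root_.UpperHalfPlane _root_.Polynomial
open _root_.Literature.NumberTheory.Automorphic
open _root_.Literature.NumberTheory.QuadraticFields.Quadratic (BinQF)
open scoped Real Topology ENNReal NNReal Modular MatrixGroups Pointwise Laplacian
open _root_.ModularGroup (T)

namespace DFI1995

/-! ## Part A. The pointwise bound for `Γ₀(q)`-invariant functions by `L²`-norms -/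

/-! ### The Euclidean local bound -/

/-- **Euclidean local bound.** For `r > 0` there is `C ≥ 0` such that for every open `U ⊆ ℂ`,
every `F ∈ C²(U)` and every closed disc `B̄(c, r) ⊆ U`,
`|F(c)|² ≤ C (∫_{B̄(c,r)} |F|² + ∫_{B̄(c,r)} |∂ₓ²F + ∂ᵧ²F|²)`. (interior Sobolev estimate). [folklore] -/
theorem exists_euclidean_local_bound {r : ℝ} (hr : 0 < r) :
    ∃ C : ℝ, 0 ≤ C ∧ ∀ (U : Set ℂ), IsOpen U → ∀ F : ℂ → ℂ, ContDiffOn ℝ 2 F U → ∀ c : ℂ,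
      Metric.closedBall c r ⊆ U →
        ‖F c‖ ^ 2 ≤ C * ((∫ w in Metric.closedBall c r, ‖F w‖ ^ 2) +
          ∫ w in Metric.closedBall c r,
            ‖fderiv ℝ (fun v => fderiv ℝ F v 1) w 1 + fderiv ℝ (fun v => fderiv ℝ F v Complex.I) w Complex.I‖ ^ 2) := by
  obtain ⟨L₁, L₂, L', hcut⟩ := exists_uniform_cutoffs (r₁ := r / 3) (r₂ := 2 * r / 3) (r₃ := r)
    (by linarith) (by linarith) (by linarith)
  obtain ⟨CS, hCS0, hCS⟩ := norm_le_of_laplacian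
  set A₁ : ℝ := 3 + 24 * L₁ ^ 2 with hA₁
  set A₂ : ℝ := 24 * L₁ ^ 2 * (1 + 8 * L' ^ 2) + 12 * L₂ ^ 2 with hA₂
  have hA₁0 : 0 ≤ A₁ := by rw [hA₁]; positivity
  have hA₂0 : 0 ≤ A₂ := by rw [hA₂]; positivity
  refine ⟨2 * CS ^ 2 * (1 + A₁ + A₂), mul_nonneg (by positivity) (by linarith), fun U hU F hF c hcU => ?_⟩
  obtain ⟨χ, χ', hχ, hχs, hχ', hχ's, hχ'B, hnest, hχ1, hχ'1, hχc, hL₁, hL₂, hL'⟩ := hcut c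
  have hχ'U : tsupport χ' ⊆ U := hχ'B.trans hcU
  obtain ⟨hg2, hgs, hIg, hIΔ⟩ :=
    cutoff_mul_estimates hU hF hχ hχs hχ' hχ's hχ'U hnest hχ1 hχ'1 hL₁ hL₂ hL'
  have hpt := hCS _ hg2 hgs c
  simp only [hχc, Complex.ofReal_one, one_mul] at hpt
  -- integrability on the disc
  have hB : IsCompact (Metric.closedBall c r) := isCompact_closedBall c r
  have hFc : ContinuousOn F U := hF.continuousOn
  have hDF1 : ∀ e, ContDiffOn ℝ 1 (fun w => fderiv ℝ F w e) U := fun e =>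
    (hF.fderiv_of_isOpen hU (by norm_num)).clm_apply contDiffOn_const
  have hD2c : ∀ e, ContinuousOn (fun z => fderiv ℝ (fun w => fderiv ℝ F w e) z e) U := fun e =>
    ((hDF1 e).continuousOn_fderiv_of_isOpen hU le_rfl).clm_apply continuousOn_const
  have hIF : IntegrableOn (fun w => ‖F w‖ ^ 2) (Metric.closedBall c r) :=
    ContinuousOn.integrableOn_compact hB ((hFc.mono hcU).norm.pow 2)
  have hIL : IntegrableOn (fun w => ‖fderiv ℝ (fun v => fderiv ℝ F v 1) w 1 +
      fderiv ℝ (fun v => fderiv ℝ F v Complex.I) w Complex.I‖ ^ 2) (Metric.closedBall c r) :=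
    ContinuousOn.integrableOn_compact hB ((((hD2c 1).add (hD2c Complex.I)).mono hcU).norm.pow 2)
  set IF := ∫ w in Metric.closedBall c r, ‖F w‖ ^ 2 with hIFdef
  set IL := ∫ w in Metric.closedBall c r, ‖fderiv ℝ (fun v => fderiv ℝ F v 1) w 1 +
      fderiv ℝ (fun v => fderiv ℝ F v Complex.I) w Complex.I‖ ^ 2 with hILdef
  have hIF0 : 0 ≤ IF := integral_nonneg fun w => by positivity
  have hIL0 : 0 ≤ IL := integral_nonneg fun w => by positivity
  -- from `tsupport χ'` to the disc
  have hmF : ∫ z in tsupport χ', ‖F z‖ ^ 2 ≤ IF :=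
    setIntegral_mono_set hIF (Eventually.of_forall fun w => by positivity) (Eventually.of_forall hχ'B)
  have hmL : ∫ z in tsupport χ', ‖fderiv ℝ (fun v => fderiv ℝ F v 1) z 1 +
      fderiv ℝ (fun v => fderiv ℝ F v Complex.I) z Complex.I‖ ^ 2 ≤ IL :=
    setIntegral_mono_set hIL (Eventually.of_forall fun w => by positivity) (Eventually.of_forall hχ'B)
  have ha : ∫ z, ‖(χ z : ℂ) * F z‖ ^ 2 ≤ IF := hIg.trans hmF
  have hb : ∫ z, ‖Δ (fun z => (χ z : ℂ) * F z) z‖ ^ 2 ≤ A₁ * IL + A₂ * IF := by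
    refine hIΔ.trans ?_
    exact add_le_add (mul_le_mul_of_nonneg_left hmL hA₁0) (mul_le_mul_of_nonneg_left hmF hA₂0)
  have ha0 : 0 ≤ ∫ z, ‖(χ z : ℂ) * F z‖ ^ 2 := integral_nonneg fun w => by positivity
  have hb0 : 0 ≤ ∫ z, ‖Δ (fun z => (χ z : ℂ) * F z) z‖ ^ 2 := integral_nonneg fun w => by positivity
  -- `(√a + √b)² ≤ 2(a + b)`
  have hsq : (Real.sqrt (∫ z, ‖(χ z : ℂ) * F z‖ ^ 2) +
      Real.sqrt (∫ z, ‖Δ (fun z => (χ z : ℂ) * F z) z‖ ^ 2)) ^ 2 ≤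
      2 * ((∫ z, ‖(χ z : ℂ) * F z‖ ^ 2) + ∫ z, ‖Δ (fun z => (χ z : ℂ) * F z) z‖ ^ 2) := by
    nlinarith [Real.sq_sqrt ha0, Real.sq_sqrt hb0,
      sq_nonneg (Real.sqrt (∫ z, ‖(χ z : ℂ) * F z‖ ^ 2) -
        Real.sqrt (∫ z, ‖Δ (fun z => (χ z : ℂ) * F z) z‖ ^ 2))]
  have h1 : ‖F c‖ ^ 2 ≤ CS ^ 2 * (2 * ((∫ z, ‖(χ z : ℂ) * F z‖ ^ 2) +
      ∫ z, ‖Δ (fun z => (χ z : ℂ) * F z) z‖ ^ 2)) := by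
    have := pow_le_pow_left₀ (norm_nonneg _) hpt 2
    rw [mul_pow] at this
    exact this.trans (mul_le_mul_of_nonneg_left hsq (by positivity))
  have h2 : (∫ z, ‖(χ z : ℂ) * F z‖ ^ 2) + ∫ z, ‖Δ (fun z => (χ z : ℂ) * F z) z‖ ^ 2 ≤
      (1 + A₁ + A₂) * (IF + IL) := by
    nlinarith [ha, hb, mul_nonneg hA₁0 hIF0, mul_nonneg hA₂0 hIL0, hIL0, hIF0]
  have h3 : CS ^ 2 * (2 * ((∫ z, ‖(χ z : ℂ) * F z‖ ^ 2) + ∫ z, ‖Δ (fun z => (χ z : ℂ) * F z) z‖ ^ 2)) ≤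
      CS ^ 2 * (2 * ((1 + A₁ + A₂) * (IF + IL))) :=
    mul_le_mul_of_nonneg_left (by linarith) (sq_nonneg _)
  calc ‖F c‖ ^ 2 ≤ CS ^ 2 * (2 * ((1 + A₁ + A₂) * (IF + IL))) := h1.trans h3
    _ = 2 * CS ^ 2 * (1 + A₁ + A₂) * (IF + IL) := by ring

/-! ### The pointwise bound -/

/-- `Δ` commutes with `σ ∈ SL₂(ℤ)` on `C²` functions. [folklore] -/
theorem hypLaplacian_comp_sl_smul {u : ℍ → ℂ} (hu : IsC2 u) (σ : SL(2, ℤ)) (z : ℍ) :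
    hypLaplacian (fun w => u (σ • w)) z = hypLaplacian u (σ • z) := by
  have h := hypLaplacian_comp_smul (det_mapGL_pos σ) u z
    (ContDiffOn.contDiffAt hu (isOpen_upperHalfPlaneSet.mem_nhds
      ((Matrix.SpecialLinearGroup.mapGL ℝ σ : GL (Fin 2) ℝ) • z).im_pos))
  exact h

/-- **The pointwise bound, uniform in the level.** Given `X` and `0 < y₁`, `y₂`, there is a finite
constant `C` such that for every `q`, every fundamental domain `F` of `Γ₀(q)`, every
`Γ₀(q)`-invariant `u ∈ C²(ℍ)`, every `σ ∈ SL₂(ℤ)` and every `z₀` with `|Re z₀| ≤ X`,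
`y₁ ≤ Im z₀ ≤ y₂`:  `|u(σ z₀)|² ≤ C (∫_F |u|² dμ + ∫_F |Δu|² dμ)`.
(Substitute for [DFI1995, Prop. 3]: local Sobolev inequality and folding instead of the pre-trace
formula.) [cite: DukeFriedlanderIwaniec1995, Prop. 3 p. 431] -/
theorem exists_pointwise_bound (X : ℝ) {y₁ : ℝ} (y₂ : ℝ) (hy₁ : 0 < y₁) :
    ∃ C : ℝ≥0∞, C ≠ ⊤ ∧ ∀ (q : ℕ) (F : Set ℍ), IsHypFundamentalDomain (Gamma0GL q) F →
      ∀ u : ℍ → ℂ, IsC2 u → (∀ γ ∈ CongruenceSubgroup.Gamma0 q, ∀ z : ℍ, u (γ • z) = u z) →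
      ∀ (σ : SL(2, ℤ)) (z₀ : ℍ), |z₀.re| ≤ X → y₁ ≤ z₀.im → z₀.im ≤ y₂ →
        ENNReal.ofReal (‖u (σ • z₀)‖ ^ 2) ≤
          C * ((∫⁻ z in F, ‖u z‖ₑ ^ 2) + ∫⁻ z in F, ‖hypLaplacian u z‖ₑ ^ 2) := by
  -- the radius and the three constants
  set r : ℝ := y₁ / 2 with hr
  have hr0 : 0 < r := by rw [hr]; linarith
  have hry : r < y₁ := by rw [hr]; linarith
  obtain ⟨CE, hCE0, hCE⟩ := exists_euclidean_local_bound hr0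
  obtain ⟨M, hM⟩ := exists_multiplicity_discs X y₂ hry
  set c₁ : ℝ := (y₂ + r) ^ 2 with hc₁
  set c₂ : ℝ := ((y₁ - r) ^ 2)⁻¹ with hc₂
  refine ⟨ENNReal.ofReal CE * (ENNReal.ofReal c₁ + ENNReal.ofReal c₂) * (M / 2), ?_, ?_⟩
  · refine ENNReal.mul_ne_top (ENNReal.mul_ne_top ENNReal.ofReal_ne_top
      (ENNReal.add_ne_top.2 ⟨ENNReal.ofReal_ne_top, ENNReal.ofReal_ne_top⟩))
      (ENNReal.div_ne_top (ENNReal.natCast_ne_top M) (by norm_num))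
  intro q F hF u hu hinv σ z₀ hX h1 h2
  -- the translated function `v = u ∘ σ` and its planar extension
  set g : GL (Fin 2) ℝ := Matrix.SpecialLinearGroup.mapGL ℝ σ with hg
  have hsmul : ∀ z : ℍ, g • z = σ • z := fun z => rfl
  set v : ℍ → ℂ := fun w => u (σ • w) with hv
  have hvC2 : IsC2 v := IsC2.comp_smul (det_mapGL_pos σ) hu
  have hvc : Continuous v := IsC2.continuous hvC2
  have hvm : Measurable v := hvc.measurable
  have hΔv : ∀ z, hypLaplacian v z = hypLaplacian u (σ • z) := fun z => hypLaplacian_comp_sl_smul hu σ z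
  have hΔvm : Measurable (hypLaplacian v) := (continuous_hypLaplacian hvC2).measurable
  have hum : Measurable u := (IsC2.continuous hu).measurable
  have hΔum : Measurable (hypLaplacian u) := (continuous_hypLaplacian hu).measurable
  -- invariance of `|u|²` and `|Δu|²`
  have hinv1 : ∀ γ ∈ CongruenceSubgroup.Gamma0 q, ∀ z : ℍ, (‖u (γ • z)‖ₑ ^ 2) = ‖u z‖ₑ ^ 2 :=
    fun γ hγ z => by rw [hinv γ hγ z]
  have hinv2 : ∀ γ ∈ CongruenceSubgroup.Gamma0 q, ∀ z : ℍ,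
      ‖hypLaplacian u (γ • z)‖ₑ ^ 2 = ‖hypLaplacian u z‖ₑ ^ 2 := by
    intro γ hγ z
    rw [← hypLaplacian_comp_sl_smul hu γ z]
    have : (fun w => u (γ • w)) = u := funext fun w => hinv γ hγ w
    rw [this]
  -- the Euclidean bound at `c = z₀` for `Fv = v ∘ ofComplex`
  set U : Set ℂ := {z : ℂ | 0 < z.im} with hUdef
  have hU : IsOpen U := isOpen_upperHalfPlaneSet
  set c : ℂ := (z₀ : ℂ) with hcdef
  have hcim : c.im = z₀.im := UpperHalfPlane.coe_im z₀
  have hrc : r < c.im := by rw [hcim]; linarith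
  have hBU : Metric.closedBall c r ⊆ U := fun w hw => (im_pos_of_mem_closedBall hrc hw).1
  have hE := hCE U hU (v ∘ ofComplex) hvC2 c hBU
  have hvc0 : (v ∘ ofComplex) c = u (σ • z₀) := by
    simp only [Function.comp_apply, hcdef, ofComplex_apply, hv]
  rw [hvc0] at hE
  -- integrability of the two planar integrands on the disc, and passage to `ℝ≥0∞`
  have hB : IsCompact (Metric.closedBall c r) := isCompact_closedBall c r
  have hvC2' : ContDiffOn ℝ 2 (v ∘ ofComplex) U := hvC2
  have hFc : ContinuousOn (v ∘ ofComplex) U := hvC2'.continuousOn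
  have hDF1 : ∀ e, ContDiffOn ℝ 1 (fun w => fderiv ℝ (v ∘ ofComplex) w e) U := fun e =>
    (hvC2'.fderiv_of_isOpen hU (by norm_num)).clm_apply contDiffOn_const
  have hD2c : ∀ e, ContinuousOn (fun z => fderiv ℝ (fun w => fderiv ℝ (v ∘ ofComplex) w e) z e) U :=
    fun e => ((hDF1 e).continuousOn_fderiv_of_isOpen hU le_rfl).clm_apply continuousOn_const
  have hIF : IntegrableOn (fun w => ‖(v ∘ ofComplex) w‖ ^ 2) (Metric.closedBall c r) :=
    ContinuousOn.integrableOn_compact hB ((hFc.mono hBU).norm.pow 2)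
  have hIL : IntegrableOn (fun w => ‖fderiv ℝ (fun v' => fderiv ℝ (v ∘ ofComplex) v' 1) w 1 +
      fderiv ℝ (fun v' => fderiv ℝ (v ∘ ofComplex) v' Complex.I) w Complex.I‖ ^ 2) (Metric.closedBall c r) :=
    ContinuousOn.integrableOn_compact hB ((((hD2c 1).add (hD2c Complex.I)).mono hBU).norm.pow 2)
  have hofF : ENNReal.ofReal (∫ w in Metric.closedBall c r, ‖(v ∘ ofComplex) w‖ ^ 2) =
      ∫⁻ w in Metric.closedBall c r, ‖v (ofComplex w)‖ₑ ^ 2 := by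
    rw [ofReal_integral_eq_lintegral_ofReal hIF (Eventually.of_forall fun w => by positivity)]
    refine lintegral_congr fun w => ?_
    simp only [Function.comp_apply]
    rw [← ofReal_norm, ENNReal.ofReal_pow (norm_nonneg _)]
  have hofL : ENNReal.ofReal (∫ w in Metric.closedBall c r,
      ‖fderiv ℝ (fun v' => fderiv ℝ (v ∘ ofComplex) v' 1) w 1 +
        fderiv ℝ (fun v' => fderiv ℝ (v ∘ ofComplex) v' Complex.I) w Complex.I‖ ^ 2) =
      ∫⁻ w in Metric.closedBall c r, ‖fderiv ℝ (fun v' => fderiv ℝ (v ∘ ofComplex) v' 1) w 1 +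
        fderiv ℝ (fun v' => fderiv ℝ (v ∘ ofComplex) v' Complex.I) w Complex.I‖ₑ ^ 2 := by
    rw [ofReal_integral_eq_lintegral_ofReal hIL (Eventually.of_forall fun w => by positivity)]
    refine lintegral_congr fun w => ?_
    rw [← ofReal_norm, ENNReal.ofReal_pow (norm_nonneg _)]
  -- the two transfers to `ℍ` and the two foldings
  set S : Set ℍ := {z : ℍ | (z : ℂ) ∈ Metric.closedBall c r} with hSdef
  have hSm : MeasurableSet S := measurableSet_coe_preimage_closedBall c r
  have hMS : ∀ w : ℍ, ∑' γ : (𝒮ℒ : Subgroup (GL (Fin 2) ℝ)), S.indicator (1 : ℍ → ℝ≥0∞) (γ • w) ≤ M :=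
    hM z₀ hX h1 h2
  have hT1 := setLIntegral_closedBall_enorm_sq_le hvm hrc
  have hT2 := setLIntegral_closedBall_laplacian_enorm_sq_le hvC2 hΔvm hrc
  have hF1 : ∫⁻ z in S, ‖v z‖ₑ ^ 2 ≤ M / 2 * ∫⁻ z in F, ‖u z‖ₑ ^ 2 :=
    setLIntegral_comp_smul_le_of_multiplicity hF (hum.enorm.pow_const 2) hinv1 hSm hMS σ
  have hF2 : ∫⁻ z in S, ‖hypLaplacian v z‖ₑ ^ 2 ≤ M / 2 * ∫⁻ z in F, ‖hypLaplacian u z‖ₑ ^ 2 := by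
    simp_rw [hΔv]
    exact setLIntegral_comp_smul_le_of_multiplicity hF (hΔum.enorm.pow_const 2) hinv2 hSm hMS σ
  -- constants
  have hc₁' : (c.im + r) ^ 2 ≤ c₁ := by
    rw [hc₁, hcim]; exact pow_le_pow_left₀ (by linarith) (by linarith) 2
  have hc₂' : ((c.im - r) ^ 2)⁻¹ ≤ c₂ := by
    rw [hc₂, hcim, inv_le_inv₀ (pow_pos (by linarith) 2) (pow_pos (by linarith) 2)]
    exact pow_le_pow_left₀ (by linarith) (by linarith) 2
  -- assemble in `ℝ≥0∞`
  set IF := ∫ w in Metric.closedBall c r, ‖(v ∘ ofComplex) w‖ ^ 2 with hIFdef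
  set IL := ∫ w in Metric.closedBall c r, ‖fderiv ℝ (fun v' => fderiv ℝ (v ∘ ofComplex) v' 1) w 1 +
      fderiv ℝ (fun v' => fderiv ℝ (v ∘ ofComplex) v' Complex.I) w Complex.I‖ ^ 2 with hILdef
  have hIF0 : 0 ≤ IF := integral_nonneg fun w => by positivity
  have hIL0 : 0 ≤ IL := integral_nonneg fun w => by positivity
  set JU := ∫⁻ z in F, ‖u z‖ₑ ^ 2 with hJU
  set JΔ := ∫⁻ z in F, ‖hypLaplacian u z‖ₑ ^ 2 with hJΔ
  have hA : ENNReal.ofReal IF ≤ ENNReal.ofReal c₁ * (M / 2 * JU) := by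
    rw [hofF]
    refine hT1.trans ?_
    exact mul_le_mul' (ENNReal.ofReal_le_ofReal hc₁') hF1
  have hBnd : ENNReal.ofReal IL ≤ ENNReal.ofReal c₂ * (M / 2 * JΔ) := by
    rw [hofL]
    refine hT2.trans ?_
    exact mul_le_mul' (ENNReal.ofReal_le_ofReal hc₂') hF2
  set K : ℝ≥0∞ := ENNReal.ofReal CE * (ENNReal.ofReal c₁ + ENNReal.ofReal c₂) * (M / 2) with hKdef
  have hK1 : ENNReal.ofReal CE * (ENNReal.ofReal c₁ * (M / 2 * JU)) ≤ K * JU := by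
    rw [hKdef, show ENNReal.ofReal CE * (ENNReal.ofReal c₁ * (M / 2 * JU)) =
      ENNReal.ofReal CE * ENNReal.ofReal c₁ * (M / 2) * JU by ring]
    gcongr
    exact le_self_add
  have hK2 : ENNReal.ofReal CE * (ENNReal.ofReal c₂ * (M / 2 * JΔ)) ≤ K * JΔ := by
    rw [hKdef, show ENNReal.ofReal CE * (ENNReal.ofReal c₂ * (M / 2 * JΔ)) =
      ENNReal.ofReal CE * ENNReal.ofReal c₂ * (M / 2) * JΔ by ring]
    gcongr
    exact le_add_self
  calc ENNReal.ofReal (‖u (σ • z₀)‖ ^ 2) ≤ ENNReal.ofReal (CE * (IF + IL)) := ENNReal.ofReal_le_ofReal hE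
    _ = ENNReal.ofReal CE * ENNReal.ofReal IF + ENNReal.ofReal CE * ENNReal.ofReal IL := by
        rw [ENNReal.ofReal_mul hCE0, ENNReal.ofReal_add hIF0 hIL0, mul_add]
    _ ≤ ENNReal.ofReal CE * (ENNReal.ofReal c₁ * (M / 2 * JU)) +
          ENNReal.ofReal CE * (ENNReal.ofReal c₂ * (M / 2 * JΔ)) := by
        gcongr
    _ ≤ K * JU + K * JΔ := add_le_add hK1 hK2
    _ = K * (JU + JΔ) := (mul_add _ _ _).symm


/-! ## Part B. Proposition 4 -/

/-! ### The fundamental domain of `Γ₀(q)` has finite volume; Bochner versus Lebesgue -/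

/-- `vol(⋃_{t ∈ T} t𝒟) < ∞`. [cite: Iwaniec2002, §2.4 Prop. 2.4] -/
theorem volume_gamma0Domain_lt_top (T₀ : Finset SL(2, ℤ)) : volume (gamma0Domain T₀) < ⊤ := by
  classical
  have hrepr : gamma0Domain T₀ = ⋃ t ∈ T₀, (fun z : ℍ => t⁻¹ • z) ⁻¹' 𝒟 := by
    ext z; simp [gamma0Domain]
  rw [hrepr]
  refine (measure_biUnion_finset_le T₀ _).trans_lt ?_
  refine ENNReal.sum_lt_top.2 fun t _ => ?_
  have h1 : volume ((fun z : ℍ => t⁻¹ • z) ⁻¹' 𝒟) ≤ volume 𝒟 := by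
    have := measure_preimage_smul_le (volume : Measure ℍ)
      (Matrix.SpecialLinearGroup.mapGL ℝ t⁻¹ : GL (Fin 2) ℝ) 𝒟
    exact this
  exact h1.trans_lt volume_modular_fd_lt_top

/-- For a bounded measurable `u` and a set of finite volume, `∫⁻_F ‖u‖ₑ² = ofReal (∫_F |u|²)`.
[folklore] -/
theorem setLIntegral_enorm_sq_eq_ofReal {u : ℍ → ℂ} (hum : Measurable u) {C : ℝ} (hC : ∀ z, ‖u z‖ ≤ C)
    {F : Set ℍ} (hFv : volume F < ⊤) :
    ∫⁻ z in F, ‖u z‖ₑ ^ 2 = ENNReal.ofReal (∫ z in F, ‖u z‖ ^ 2) := by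
  have hint : IntegrableOn (fun z => ‖u z‖ ^ 2) F := by
    refine Measure.integrableOn_of_bounded (M := C ^ 2) hFv.ne (hum.norm.pow_const 2).aestronglyMeasurable ?_
    refine Eventually.of_forall fun z => ?_
    rw [Real.norm_of_nonneg (sq_nonneg _)]
    exact pow_le_pow_left₀ (norm_nonneg _) (hC z) 2
  rw [ofReal_integral_eq_lintegral_ofReal hint (Eventually.of_forall fun z => sq_nonneg _)]
  refine lintegral_congr fun z => ?_
  rw [← ofReal_norm, ENNReal.ofReal_pow (norm_nonneg _)]

/-! ### The quadratic of the paper in the tree's conventions -/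

/-- `quad a b c = aX² + 2bX + c` is the tree's `C a X² + C (2b) X + C c`. [folklore] -/
theorem quad_eq (a b c : ℤ) : DFI1995.quad a b c = C a * X ^ 2 + C (2 * b) * X + C c := rfl

/-- `quad (−a) (−b) (−c) = −quad a b c`. [folklore] -/
theorem quad_neg (a b c : ℤ) : DFI1995.quad (-a) (-b) (-c) = -DFI1995.quad a b c := by
  simp only [quad_eq, map_neg, mul_neg, map_mul]
  ring

/-- The discriminant of `aX² + 2bX + c` is `−4(ac − b²)`. [folklore] -/
theorem discrim_two_mul (a b c : ℤ) : discrim a (2 * b) c = -(4 * (a * c - b ^ 2)) := by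
  rw [discrim]; ring

/-! ### The weight identity: `ψ(z_Q) = G(A/a) e(h(B − 2b)/2A)` -/

/-- **The kernel at a Heegner point is the Weyl weight.**  For `a > 0`, the level form
`Q = [A, B, C]` (`a ∣ q ∣ A`, `A > 0`, disc `Δ < 0`) and the kernel
`ψ(z) = G(κ/Im z) e(−βh Im z) e(−h Re z)` with `κ = √|Δ|/2a`, `β = 2b/√|Δ|`:
`ψ(z_Q) = G(A/a) e(h(B − 2b)/(2A))`. [cite: DukeFriedlanderIwaniec1995, (13)–(14) p. 428, §4 p. 432] -/
theorem stripKernel_heegnerPt_eq {a b' : ℤ} (ha : 0 < a) {Q : BinQF} (hA : 0 < Q.a) (hQΔ : Q.disc < 0)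
    (haA : a ∣ Q.a) (G : ℝ → ℂ) (h : ℤ) :
    let κ : ℝ := Real.sqrt (-(Q.disc : ℝ)) / (2 * a)
    let β : ℝ := (b' : ℝ) / Real.sqrt (-(Q.disc : ℝ))
    (G (κ / (RootForms.heegnerPt Q hA hQΔ).im) *
        Complex.exp (2 * π * Complex.I * (-(β * h) : ℝ) * (((RootForms.heegnerPt Q hA hQΔ).im : ℝ) : ℂ))) *
      Complex.exp (2 * π * Complex.I * ((-h : ℤ) : ℂ) * (((RootForms.heegnerPt Q hA hQΔ).re : ℝ) : ℂ)) =
      G ((Q.a / a : ℤ) : ℝ) * RootForms.ex (h * ((Q.b : ℝ) - b') / (2 * Q.a)) := by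
  intro κ β
  have hre : (RootForms.heegnerPt Q hA hQΔ).re = -(Q.b : ℝ) / (2 * Q.a) := by
    show ((RootForms.heegnerPt Q hA hQΔ : ℍ) : ℂ).re = _
    rw [RootForms.coe_heegnerPt, Complex.div_ofReal_re]; simp
  have him : (RootForms.heegnerPt Q hA hQΔ).im = Real.sqrt (-(Q.disc : ℝ)) / (2 * Q.a) := by
    show ((RootForms.heegnerPt Q hA hQΔ : ℍ) : ℂ).im = _
    rw [RootForms.coe_heegnerPt, Complex.div_ofReal_im]; simp
  have hs : 0 < Real.sqrt (-(Q.disc : ℝ)) := Real.sqrt_pos.2 (by exact_mod_cast neg_pos.2 hQΔ)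
  have hA' : (0 : ℝ) < Q.a := by exact_mod_cast hA
  have ha' : (0 : ℝ) < a := by exact_mod_cast ha
  obtain ⟨n, hn⟩ := haA
  have hdiv : ((Q.a / a : ℤ) : ℝ) = (Q.a : ℝ) / a := by
    rw [hn, Int.mul_ediv_cancel_left _ ha.ne']
    push_cast
    field_simp
  -- `κ / Im z_Q = A/a`
  have hκ : κ / (RootForms.heegnerPt Q hA hQΔ).im = (Q.a : ℝ) / a := by
    rw [him]
    simp only [κ]
    field_simp
  have hs0 : Real.sqrt (-(Q.disc : ℝ)) ≠ 0 := hs.ne'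
  have hs0' : ((Real.sqrt (-(Q.disc : ℝ)) : ℝ) : ℂ) ≠ 0 := by exact_mod_cast hs0
  have hA0' : ((Q.a : ℝ) : ℂ) ≠ 0 := by exact_mod_cast hA'.ne'
  rw [hκ, hdiv, mul_assoc, ← Complex.exp_add, RootForms.ex, him, hre]
  congr 1
  simp only [β]
  congr 1
  push_cast
  field_simp
  ring

/-! ### Small analytic facts about the profile -/

section profile

variable {G : ℝ → ℂ} {N κ c : ℝ}

/-- The profile `y ↦ G(κ/y) e(c y)` is `C²` on `(0, ∞)` for `G ∈ C²`. [folklore] -/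
theorem contDiffOn_profile (hG : ContDiff ℝ 2 G) (κ c : ℝ) :
    ContDiffOn ℝ 2 (fun y : ℝ => G (κ / y) * Complex.exp (2 * π * Complex.I * c * (y : ℂ))) (Ioi 0) := by
  have h1 : ContDiffOn ℝ 2 (fun y : ℝ => κ / y) (Ioi 0) :=
    contDiffOn_const.div contDiffOn_id fun y hy => ne_of_gt hy
  exact (hG.comp_contDiffOn h1).mul (contDiff_exp_two_pi c).contDiffOn

/-- The profile is measurable. [folklore] -/
theorem measurable_profile (hG : Continuous G) (κ c : ℝ) :
    Measurable (fun y : ℝ => G (κ / y) * Complex.exp (2 * π * Complex.I * c * (y : ℂ))) :=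
  (hG.measurable.comp (measurable_const.div measurable_id)).mul (contDiff_exp_two_pi c (n := 0)).continuous.measurable

/-- The Laplace profile `y²(Φ'' − λΦ)` is measurable. [folklore] -/
theorem measurable_laplaceProfile (Φ : ℝ → ℂ) (hΦm : Measurable Φ) (lam : ℝ) :
    Measurable (fun y : ℝ => ((y : ℝ) : ℂ) ^ 2 * (iteratedDeriv 2 Φ y - (lam : ℂ) * Φ y)) := by
  have h2 : Measurable (iteratedDeriv 2 Φ) := by
    rw [iteratedDeriv_succ, iteratedDeriv_one]; exact measurable_deriv _
  exact ((Complex.continuous_ofReal.measurable.comp measurable_id).pow_const 2).mul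
    (h2.sub (hΦm.const_mul _))

/-- A function vanishing off a closed interval has its second derivative vanishing off it too.
[folklore] -/
theorem iteratedDeriv_two_eq_zero_of_support {Φ : ℝ → ℂ} {Y₁ Y₂ : ℝ}
    (hsupp : ∀ y, Φ y ≠ 0 → Y₁ ≤ y ∧ y ≤ Y₂) {y : ℝ} (hy : ¬ (Y₁ ≤ y ∧ y ≤ Y₂)) :
    iteratedDeriv 2 Φ y = 0 ∧ Φ y = 0 := by
  have hts : tsupport Φ ⊆ Icc Y₁ Y₂ := closure_minimal (fun t ht => hsupp t ht) isClosed_Icc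
  have hy' : y ∉ Icc Y₁ Y₂ := hy
  refine ⟨?_, ?_⟩
  · rw [iteratedDeriv_succ, iteratedDeriv_one]
    by_contra h0
    exact hy' (hts (tsupport_deriv_subset (support_deriv_subset (Function.mem_support.2 h0))))
  · by_contra h0
    exact hy' (hts (subset_tsupport _ (Function.mem_support.2 h0)))

/-- The derivative bounds `|G^{(j)}| ≤ N^{-j}`, `j = 0, 1, 2`, unpacked. [folklore] -/
theorem deriv_bounds_of_iteratedDeriv (hN : 0 < N)
    (hGj : ∀ j : ℕ, j ≤ 4 → ∀ t : ℝ, ‖iteratedDeriv j G t‖ ≤ N ^ (-(j : ℝ))) :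
    (∀ t, ‖G t‖ ≤ 1) ∧ (∀ t, ‖deriv G t‖ ≤ N⁻¹) ∧ (∀ t, ‖deriv (deriv G) t‖ ≤ (N ^ 2)⁻¹) := by
  refine ⟨fun t => ?_, fun t => ?_, fun t => ?_⟩
  · have := hGj 0 (by norm_num) t
    simpa using this
  · have := hGj 1 (by norm_num) t
    rw [iteratedDeriv_one] at this
    simpa [Real.rpow_neg_one] using this
  · have := hGj 2 (by norm_num) t
    rw [iteratedDeriv_succ, iteratedDeriv_one] at this
    have e : N ^ (-((2 : ℕ) : ℝ)) = (N ^ 2)⁻¹ := by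
      rw [Real.rpow_neg hN.le, show ((2 : ℕ) : ℝ) = (2 : ℕ) by norm_num, Real.rpow_natCast]
    rwa [e] at this

end profile

/-! ### Elementary arithmetic for the final bound -/

section arithmetic

/-- `gcd(h, ad) ≤ a · gcd(h, d)` and `τ(h a d) ≤ τ(a) τ(h d)`. [folklore] -/
theorem gcd_tau_level_le (h a d : ℕ) (ha : 0 < a) (hh : 0 < h) :
    (Nat.gcd h (a * d) : ℝ) ≤ a * Nat.gcd h d ∧
      ((h * (a * d)).divisors.card : ℝ) ≤ (a.divisors.card : ℝ) * ((h * d).divisors.card : ℝ) := by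
  constructor
  · have h1 : Nat.gcd h (a * d) ∣ Nat.gcd h a * Nat.gcd h d := Nat.gcd_mul_right_dvd_mul_gcd h a d
    have h2 : Nat.gcd h (a * d) ≤ Nat.gcd h a * Nat.gcd h d :=
      Nat.le_of_dvd (Nat.mul_pos (Nat.gcd_pos_of_pos_left _ hh) (Nat.gcd_pos_of_pos_left _ hh)) h1
    have h3 : Nat.gcd h a ≤ a := Nat.gcd_le_right _ ha
    have : Nat.gcd h (a * d) ≤ a * Nat.gcd h d := h2.trans (Nat.mul_le_mul_right _ h3)
    exact_mod_cast this
  · have e : h * (a * d) = a * (h * d) := by ring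
    rw [e]
    exact_mod_cast card_divisors_mul_le' a (h * d)

end arithmetic

/-! ### The weight identity on level forms -/

/-- **`ψ(z_Q) = w(Q)` on level forms.**  With `q = ad`, `N' = ⌊2N⌋`, the kernel
`ψ(z) = G(κ/Im z) e(−βh Im z) e(−h Re z)` (`κ = √|Δ|/2a`, `β = 2b/√|Δ|`) takes at the Heegner point
of a level form `Q` the value of the Weyl weight
`w(Q) = [0 < A ≤ aN'] G(A/a) e(h(B − 2b)/2A)` (for `A > aN'`, `A/a > 2N` and `G(A/a) = 0`).
[cite: DukeFriedlanderIwaniec1995, (13)–(14) p. 428, §4 p. 432] -/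
theorem stripKernel_heegnerPt_eq_weylWeight {a b' c : ℤ} (ha : 0 < a)
    {d : ℕ} {N : ℝ} (G : ℝ → ℂ) (hG0 : ∀ t, G t ≠ 0 → N ≤ t ∧ t ≤ 2 * N) (h : ℕ)
    {Q : BinQF} (hA : 0 < Q.a) (hQΔ : Q.disc < 0)
    (hQ : RootForms.IsLevelForm a b' (discrim a b' c) (a.toNat * d) Q) :
    let κ : ℝ := Real.sqrt |((discrim a b' c : ℤ) : ℝ)| / (2 * a)
    let β : ℝ := (b' : ℝ) / Real.sqrt |((discrim a b' c : ℤ) : ℝ)|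
    (G (κ / (RootForms.heegnerPt Q hA hQΔ).im) *
        Complex.exp (2 * π * Complex.I * (-(β * h) : ℝ) * (((RootForms.heegnerPt Q hA hQΔ).im : ℝ) : ℂ))) *
      Complex.exp (2 * π * Complex.I * ((-(h : ℤ) : ℤ) : ℂ) * (((RootForms.heegnerPt Q hA hQΔ).re : ℝ) : ℂ)) =
      RootForms.weylWeight a b' d ⌊2 * N⌋₊ h (fun n : ℕ => G n) Q := by
  intro κ β
  simp only [κ, β]
  have hdisc : Q.disc = discrim a b' c := hQ.disc_eq
  have habs : |((discrim a b' c : ℤ) : ℝ)| = -(Q.disc : ℝ) := by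
    rw [← hdisc, abs_of_neg (by exact_mod_cast hQΔ)]
  have hadvd : a ∣ ((a.toNat * d : ℕ) : ℤ) := by
    rw [Nat.cast_mul, Int.toNat_of_nonneg ha.le]; exact dvd_mul_right a d
  have haA : a ∣ Q.a := hadvd.trans hQ.level_dvd
  have E := stripKernel_heegnerPt_eq (b' := b') ha hA hQΔ haA G (h : ℤ)
  simp only [] at E
  rw [← habs] at E
  push_cast at E ⊢
  rw [E]
  -- the index
  obtain ⟨n, hn⟩ := haA
  have hn0 : 0 < n := by nlinarith
  have hdiv : Q.a / a = n := by rw [hn, Int.mul_ediv_cancel_left _ ha.ne']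
  have hidx : ((RootForms.index a Q : ℕ) : ℝ) = ((Q.a / a : ℤ) : ℝ) := by
    rw [RootForms.index, hdiv]
    obtain ⟨m, hm⟩ := Int.eq_ofNat_of_zero_le hn0.le
    rw [hm, Int.toNat_natCast]
    norm_cast
  unfold RootForms.weylWeight
  by_cases hle : Q.a ≤ a * (⌊2 * N⌋₊ : ℕ)
  · rw [if_pos ⟨hQ.level_dvd, hA, hle⟩]
    dsimp only
    rw [hidx]
    push_cast
    ring
  · rw [if_neg (fun h' => hle h'.2.2)]
    -- `A/a = n > ⌊2N⌋`, so `n > 2N` and `G n = 0`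
    have hnN : (⌊2 * N⌋₊ : ℤ) < n := by
      by_contra hc
      push Not at hc
      apply hle
      rw [hn]
      exact mul_le_mul_of_nonneg_left hc ha.le
    have hn2N : 2 * N < (n : ℝ) := by
      have h1 : 2 * N < (⌊2 * N⌋₊ : ℝ) + 1 := Nat.lt_floor_add_one _
      have h2 : ((⌊2 * N⌋₊ : ℕ) : ℤ) + 1 ≤ n := hnN
      have h3 : ((⌊2 * N⌋₊ : ℕ) : ℝ) + 1 ≤ (n : ℝ) := by exact_mod_cast h2
      linarith
    have hG : G ((Q.a / a : ℤ) : ℝ) = 0 := by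
      rw [hdiv]
      by_contra hne
      have := (hG0 _ hne).2
      linarith
    rw [hG, zero_mul]

/-! ### The analytic core: the Poincaré series at the Heegner points -/

set_option maxHeartbeats 800000 in
/-- **The analytic core of Proposition 4.**  For `a > 0`, `Δ = b'² − 4ac < 0` and `C₂ > 0` there
is `C₀ ≥ 0` such that for all `h, d ≥ 1`, `N ≥ 1` with `h ≤ C₂N` and all admissible `G`, the
Poincaré series `P_ψ` on `Γ₀(ad)` of the kernel `ψ(z) = G(κ/Im z) e(−βh Im z) e(−h Re z)`
satisfies, at the Heegner point of every positive definite level form `R`,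
`|P_ψ(z_R)|² ≤ C₀ N (1 + 256√2 · √(h,q) τ(hq) q⁻¹ √X (1 + log X))`, `X = max(1, 2N/κ)`, `q = ad`
(pointwise bound by `L²`-norms of `P_ψ` and `ΔP_ψ = P_{Δψ}`, and the unfolding/Weil bound for
these norms). [cite: DukeFriedlanderIwaniec1995, Prop. 3 p. 431 and §3] -/
theorem norm_sq_poincareFn_heegnerPt_le {a b' c : ℤ} (ha : 0 < a) (hΔ : discrim a b' c < 0)
    {C₂ : ℝ} (hC₂ : 0 < C₂) :
    ∃ C₀ : ℝ, 0 ≤ C₀ ∧ ∀ h : ℕ, 1 ≤ h → ∀ d : ℕ, 1 ≤ d → ∀ N : ℝ, 1 ≤ N → (h : ℝ) ≤ C₂ * N →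
      ∀ G : ℝ → ℂ, ContDiff ℝ 4 G → (∀ t : ℝ, G t ≠ 0 → N ≤ t ∧ t ≤ 2 * N) →
        (∀ j : ℕ, j ≤ 4 → ∀ t : ℝ, ‖iteratedDeriv j G t‖ ≤ N ^ (-(j : ℝ))) →
        ∀ (R : BinQF) (hA : 0 < R.a) (hRΔ : R.disc < 0),
          RootForms.IsLevelForm a b' (discrim a b' c) (a.toNat * d) R →
          ‖RootForms.poincareFn (a.toNat * d)
              (fun z : ℍ => ((fun y : ℝ => G (Real.sqrt |((discrim a b' c : ℤ) : ℝ)| / (2 * a) / y) *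
                  Complex.exp (2 * π * Complex.I *
                    (-(((b' : ℝ) / Real.sqrt |((discrim a b' c : ℤ) : ℝ)|) * h) : ℝ) * (y : ℂ))) z.im) *
                Complex.exp (2 * π * Complex.I * ((-(h : ℤ) : ℤ) : ℂ) * (z.re : ℂ)))
              (RootForms.heegnerPt R hA hRΔ)‖ ^ 2 ≤
            C₀ * N * (1 + 256 * Real.sqrt 2 *
              (Real.sqrt (Nat.gcd h (a.toNat * d)) * ((h * (a.toNat * d)).divisors.card : ℝ) / (a.toNat * d : ℕ) *
                Real.sqrt (max 1 (2 * N / (Real.sqrt |((discrim a b' c : ℤ) : ℝ)| / (2 * a)))) *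
                (1 + Real.log (max 1 (2 * N / (Real.sqrt |((discrim a b' c : ℤ) : ℝ)| / (2 * a))))))) := by
  classical
  -- constants depending on `f` and `C₂`
  set AΔ : ℝ := |((discrim a b' c : ℤ) : ℝ)| with hAΔ
  have hAΔ0 : 0 < AΔ := abs_pos.2 (by exact_mod_cast hΔ.ne)
  have hsA : 0 < Real.sqrt AΔ := Real.sqrt_pos.2 hAΔ0
  have ha' : (0 : ℝ) < a := by exact_mod_cast ha
  set X₀ : ℝ := AΔ with hX₀
  set y₁ : ℝ := 1 / (2 * Real.sqrt AΔ) with hy₁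
  set y₂ : ℝ := Real.sqrt AΔ with hy₂
  have hy₁0 : 0 < y₁ := by rw [hy₁]; exact div_pos one_pos (mul_pos two_pos hsA)
  obtain ⟨Cpt, hCpt_top, hCpt⟩ := exists_pointwise_bound X₀ y₂ hy₁0
  set κ : ℝ := Real.sqrt AΔ / (2 * a) with hκ
  have hκ0 : 0 < κ := by rw [hκ]; exact div_pos hsA (mul_pos two_pos ha')
  have hκne : κ ≠ 0 := hκ0.ne'
  set β : ℝ := (b' : ℝ) / Real.sqrt AΔ with hβ
  set Btil : ℝ := 8 + 4 * π * κ * |β| * C₂ + 4 * π ^ 2 * κ ^ 2 * |β| ^ 2 * C₂ ^ 2 +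
    4 * π ^ 2 * κ ^ 2 * C₂ ^ 2 with hBtil
  have hBtil0 : 0 ≤ Btil := by
    have h1 : 0 ≤ 4 * π * κ * |β| * C₂ :=
      mul_nonneg (mul_nonneg (mul_nonneg (mul_nonneg (by norm_num) Real.pi_pos.le) hκ0.le)
        (abs_nonneg _)) hC₂.le
    have h2 : 0 ≤ 4 * π ^ 2 * κ ^ 2 * |β| ^ 2 * C₂ ^ 2 := by positivity
    have h3 : 0 ≤ 4 * π ^ 2 * κ ^ 2 * C₂ ^ 2 := by positivity
    rw [hBtil]; linarith
  refine ⟨Cpt.toReal * (1 + Btil ^ 2) * (2 / κ),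
    mul_nonneg (mul_nonneg ENNReal.toReal_nonneg (by positivity)) (div_nonneg zero_le_two hκ0.le), ?_⟩
  intro h hh d hd N hN hhN G hG hG0 hGj R hRA hRΔ hRlev
  -- basic quantities
  have hN0 : 0 < N := by linarith
  have hNne : N ≠ 0 := hN0.ne'
  have hh0 : (0 : ℝ) < h := by exact_mod_cast hh
  set q : ℕ := a.toNat * d with hq
  have haq : (a.toNat : ℤ) = a := Int.toNat_of_nonneg ha.le
  have hq0 : 0 < q := Nat.mul_pos (by omega) (by omega)
  haveI : NeZero q := ⟨hq0.ne'⟩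
  set η : ℤ := -(h : ℤ) with hη
  have hη0 : η ≠ 0 := by simp [hη]; omega
  have hηabs : η.natAbs = h := by simp [hη]
  have hη2 : ((η : ℝ)) ^ 2 = (h : ℝ) ^ 2 := by rw [hη]; push_cast; ring
  set Y₁ : ℝ := κ / (2 * N) with hY₁
  set Y₂ : ℝ := κ / N with hY₂
  have hY₁0 : 0 < Y₁ := by rw [hY₁]; exact div_pos hκ0 (mul_pos two_pos hN0)
  have hY12 : Y₁ ≤ Y₂ := by
    rw [hY₁, hY₂, div_le_div_iff₀ (mul_pos two_pos hN0) hN0]; nlinarith [hκ0.le, hN0.le]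
  set cφ : ℝ := -(β * h) with hcφ
  set Φ : ℝ → ℂ := fun y => G (κ / y) * Complex.exp (2 * π * Complex.I * cφ * (y : ℂ)) with hΦ
  -- the profile
  have hGC2 : ContDiff ℝ 2 G := hG.of_le (by norm_num)
  obtain ⟨hGb, hG1, hG2⟩ := deriv_bounds_of_iteratedDeriv hN0 hGj
  have hΦC2 : ContDiffOn ℝ 2 Φ (Ioi 0) := contDiffOn_profile hGC2 κ cφ
  have hΦm : Measurable Φ := measurable_profile hG.continuous κ cφ
  have hΦsupp : ∀ y, Φ y ≠ 0 → Y₁ ≤ y ∧ y ≤ Y₂ := fun y hy => profile_support hN0 hκ0 hG0 hy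
  have hΦbd : ∀ y, ‖Φ y‖ ≤ 1 := fun y => norm_profile_le hGb y
  -- the kernel
  set ψ : ℍ → ℂ := fun z => Φ z.im * Complex.exp (2 * π * Complex.I * η * (z.re : ℂ)) with hψ
  have hψT : ∀ z : ℍ, ψ (T • z) = ψ z := stripKernel_T_smul Φ η
  have hψC2 : IsC2 ψ := isC2_stripKernel hΦC2 η
  have hψY' : ∀ z : ℍ, ψ z ≠ 0 → Y₁ ≤ z.im ∧ z.im ≤ Y₂ := fun z hz =>
    hΦsupp _ (apply_im_ne_zero_of_stripKernel_ne_zero hz)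
  have hψY : ∀ z : ℍ, ψ z ≠ 0 → Y₁ ≤ z.im := fun z hz => (hψY' z hz).1
  have hψbd : ∀ z : ℍ, ‖ψ z‖ ≤ 1 := fun z => by
    simp only [hψ]; rw [norm_stripKernel]; exact hΦbd _
  -- the Poincaré series
  set P : ℍ → ℂ := RootForms.poincareFn q ψ with hP
  have hPC2 : IsC2 P := isC2_poincareFn q hY₁0 hψY hψC2
  have hPm : Measurable P := (IsC2.continuous hPC2).measurable
  obtain ⟨CP0, hCP00, hCP⟩ := exists_norm_poincareFn_le Y₂ hY₁0
  have hPbd : ∀ z, ‖P z‖ ≤ CP0 * 1 := hCP q ψ 1 zero_le_one hψY' hψbd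
  have hPinv : ∀ γ ∈ CongruenceSubgroup.Gamma0 q, ∀ z : ℍ, P (γ • z) = P z := fun γ hγ z =>
    poincareFn_smul_of_mem_Gamma0 q hψT hγ z
  -- the Laplacian: `ΔP = P_{ψ̃}`, `ψ̃` the strip kernel of the Laplace profile
  set Φt : ℝ → ℂ := fun y => ((y : ℝ) : ℂ) ^ 2 *
    (iteratedDeriv 2 Φ y - (4 * π ^ 2 * (η : ℝ) ^ 2 : ℝ) * Φ y) with hΦt
  set ψt : ℍ → ℂ := fun z => Φt z.im * Complex.exp (2 * π * Complex.I * η * (z.re : ℂ)) with hψt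
  have hΔψ : (fun w : ℍ => hypLaplacian ψ w) = ψt := by
    funext w
    simp only [hψ, hψt, hΦt]
    exact hypLaplacian_stripKernel hΦC2 η w
  have hΔP : ∀ z : ℍ, hypLaplacian P z = RootForms.poincareFn q ψt z := fun z => by
    rw [hP, hypLaplacian_poincareFn q hY₁0 hψY hψC2 z, hΔψ]
  have hΦtm : Measurable Φt := measurable_laplaceProfile Φ hΦm _
  have hΦtsupp : ∀ y, Φt y ≠ 0 → Y₁ ≤ y ∧ y ≤ Y₂ := by
    intro y hy
    by_contra hc
    obtain ⟨h1, h2⟩ := iteratedDeriv_two_eq_zero_of_support hΦsupp hc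
    exact hy (by simp [hΦt, h1, h2])
  have hΦtbd : ∀ y, ‖Φt y‖ ≤ Btil := by
    intro y
    by_cases hy : 0 < y
    · have hc : |cφ| ≤ |β| * h := by
        rw [hcφ, abs_neg, abs_mul, abs_of_nonneg hh0.le]
      have := norm_laplaceProfile_le hGC2 hN hκ0 hG0 hGb hG1 hG2 hh0.le hhN (abs_nonneg β) hc hy
      simp only [hΦt, hη2]
      exact this
    · have hc : ¬ (Y₁ ≤ y ∧ y ≤ Y₂) := fun h' => hy (hY₁0.trans_le h'.1)
      obtain ⟨h1, h2⟩ := iteratedDeriv_two_eq_zero_of_support hΦsupp hc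
      simp only [hΦt, h1, h2, mul_zero, sub_zero, norm_zero]
      exact hBtil0
  have hψtY' : ∀ z : ℍ, ψt z ≠ 0 → Y₁ ≤ z.im ∧ z.im ≤ Y₂ := fun z hz =>
    hΦtsupp _ (apply_im_ne_zero_of_stripKernel_ne_zero hz)
  have hψtbd : ∀ z : ℍ, ‖ψt z‖ ≤ Btil := fun z => by
    simp only [hψt]; rw [norm_stripKernel]; exact hΦtbd _
  set Pt : ℍ → ℂ := RootForms.poincareFn q ψt with hPt
  have hPtm : Measurable Pt := by
    have : Pt = fun z => hypLaplacian P z := funext fun z => (hΔP z).symm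
    rw [this]
    exact (continuous_hypLaplacian hPC2).measurable
  have hPtbd : ∀ z, ‖Pt z‖ ≤ CP0 * Btil := hCP q ψt Btil hBtil0 hψtY' hψtbd
  -- a fundamental domain of `Γ₀(q)`
  obtain ⟨T₀, hT₀⟩ := exists_rightTransversal q
  set F : Set ℍ := gamma0Domain T₀ with hF
  have hFD : IsHypFundamentalDomain (Gamma0GL q) F := isHypFundamentalDomain_gamma0Domain hT₀
  have hFv : volume F < ⊤ := volume_gamma0Domain_lt_top T₀
  -- the `L²` bounds
  set W : ℝ := 1 + 256 * Real.sqrt (Y₂ / Y₁) * (Real.sqrt (Nat.gcd η.natAbs q) *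
    ((η.natAbs * q).divisors.card : ℝ) / q * Real.sqrt (max 1 Y₁⁻¹) * (1 + Real.log (max 1 Y₁⁻¹))) with hW
  have hI1 : ∫ w in F, ‖P w‖ ^ 2 ≤ 1 ^ 2 * ((Y₂ - Y₁) / Y₁ ^ 2) * W :=
    setIntegral_norm_sq_poincareFn_stripKernel_le hq0 hη0 hΦm hY₁0 hY12 hΦsupp hΦbd hPm hPbd hFD
  have hI2 : ∫ w in F, ‖Pt w‖ ^ 2 ≤ Btil ^ 2 * ((Y₂ - Y₁) / Y₁ ^ 2) * W :=
    setIntegral_norm_sq_poincareFn_stripKernel_le hq0 hη0 hΦtm hY₁0 hY12 hΦtsupp hΦtbd hPtm hPtbd hFD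
  have hW0 : 0 ≤ W := by
    have h1 : 0 ≤ 1 + Real.log (max 1 Y₁⁻¹) := by
      have := Real.log_nonneg (le_max_left (1 : ℝ) Y₁⁻¹); linarith
    rw [hW]
    refine add_nonneg zero_le_one (mul_nonneg (mul_nonneg (by norm_num) (Real.sqrt_nonneg _)) ?_)
    refine mul_nonneg (mul_nonneg ?_ (Real.sqrt_nonneg _)) h1
    exact div_nonneg (mul_nonneg (Real.sqrt_nonneg _) (Nat.cast_nonneg _)) (Nat.cast_nonneg _)
  have hL : (Y₂ - Y₁) / Y₁ ^ 2 = 2 * N / κ := by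
    rw [hY₁, hY₂]; field_simp; ring
  -- the pointwise bound at `z_R = ξ⁻¹ z₁`
  obtain ⟨ξ, hA', hΔ', hrep, hz⟩ := RootForms.heegnerPt_eq_smul_heegnerPt_rep hRA hRΔ
  have hdiscR : R.disc = discrim a b' c := hRlev.disc_eq
  rw [hdiscR] at hrep
  obtain ⟨hbx, hby1, hby2⟩ := RootForms.heegnerPt_mem_box_of_mem_classReps hrep hA' hΔ'
  have hpt := hCpt q F hFD P hPC2 hPinv ξ⁻¹ (RootForms.heegnerPt (RootForms.rep R) hA' hΔ')
    hbx hby1 hby2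
  rw [← hz] at hpt
  -- convert the Lebesgue integrals
  have hlin1 : ∫⁻ z in F, ‖P z‖ₑ ^ 2 = ENNReal.ofReal (∫ z in F, ‖P z‖ ^ 2) :=
    setLIntegral_enorm_sq_eq_ofReal hPm hPbd hFv
  have hlin2 : ∫⁻ z in F, ‖hypLaplacian P z‖ₑ ^ 2 = ENNReal.ofReal (∫ z in F, ‖Pt z‖ ^ 2) := by
    have : (fun z => ‖hypLaplacian P z‖ₑ ^ 2) = fun z => ‖Pt z‖ₑ ^ 2 := by
      funext z; simp only [hΔP z, hPt]
    rw [this]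
    exact setLIntegral_enorm_sq_eq_ofReal hPtm hPtbd hFv
  rw [hlin1, hlin2] at hpt
  have hI10 : 0 ≤ ∫ z in F, ‖P z‖ ^ 2 := integral_nonneg fun z => sq_nonneg _
  have hI20 : 0 ≤ ∫ z in F, ‖Pt z‖ ^ 2 := integral_nonneg fun z => sq_nonneg _
  set Bd : ℝ := (1 + Btil ^ 2) * ((Y₂ - Y₁) / Y₁ ^ 2) * W with hBd
  have hsum : (∫ z in F, ‖P z‖ ^ 2) + ∫ z in F, ‖Pt z‖ ^ 2 ≤ Bd :=
    calc (∫ z in F, ‖P z‖ ^ 2) + ∫ z in F, ‖Pt z‖ ^ 2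
        ≤ 1 ^ 2 * ((Y₂ - Y₁) / Y₁ ^ 2) * W + Btil ^ 2 * ((Y₂ - Y₁) / Y₁ ^ 2) * W := add_le_add hI1 hI2
      _ = Bd := by rw [hBd]; ring
  have hBd0 : 0 ≤ Bd := (add_nonneg hI10 hI20).trans hsum
  have hpt' : ENNReal.ofReal (‖P (RootForms.heegnerPt R hRA hRΔ)‖ ^ 2) ≤
      ENNReal.ofReal (Cpt.toReal * Bd) := by
    refine hpt.trans ?_
    calc Cpt * (ENNReal.ofReal (∫ z in F, ‖P z‖ ^ 2) + ENNReal.ofReal (∫ z in F, ‖Pt z‖ ^ 2))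
        = ENNReal.ofReal Cpt.toReal * ENNReal.ofReal ((∫ z in F, ‖P z‖ ^ 2) + ∫ z in F, ‖Pt z‖ ^ 2) := by
          rw [ENNReal.ofReal_toReal hCpt_top, ENNReal.ofReal_add hI10 hI20]
      _ = ENNReal.ofReal (Cpt.toReal * ((∫ z in F, ‖P z‖ ^ 2) + ∫ z in F, ‖Pt z‖ ^ 2)) := by
          rw [ENNReal.ofReal_mul ENNReal.toReal_nonneg]
      _ ≤ ENNReal.ofReal (Cpt.toReal * Bd) :=
          ENNReal.ofReal_le_ofReal (mul_le_mul_of_nonneg_left hsum ENNReal.toReal_nonneg)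
  have hfin : ‖P (RootForms.heegnerPt R hRA hRΔ)‖ ^ 2 ≤ Cpt.toReal * Bd :=
    (ENNReal.ofReal_le_ofReal_iff (mul_nonneg ENNReal.toReal_nonneg hBd0)).1 hpt'
  -- identify with the stated bound
  have hWq : W = 1 + 256 * Real.sqrt 2 * (Real.sqrt (Nat.gcd h q) * ((h * q).divisors.card : ℝ) / q *
      Real.sqrt (max 1 (2 * N / κ)) * (1 + Real.log (max 1 (2 * N / κ)))) := by
    have h21 : Y₂ / Y₁ = 2 := by rw [hY₁, hY₂]; field_simp
    have hinv : Y₁⁻¹ = 2 * N / κ := by rw [hY₁, inv_div]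
    rw [hW, h21, hinv, hηabs]
  refine hfin.trans (le_of_eq ?_)
  rw [hBd, hL, hWq]
  ring

/-! ### Proposition 4 for `a > 0` -/

set_option maxHeartbeats 800000 in
/-- **Proposition 4 for `a > 0`.** [cite: DukeFriedlanderIwaniec1995, Proposition 4 p. 432] -/
theorem proposition4_of_pos {a b c : ℤ} (ha : 0 < a) (hD : 0 < a * c - b ^ 2) {C₂ : ℝ} (hC₂ : 0 < C₂) :
    ∃ K : ℝ, ∀ h : ℕ, 1 ≤ h → ∀ d : ℕ, 1 ≤ d → ∀ N : ℝ, 1 ≤ N → (h : ℝ) ≤ C₂ * N →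
      ∀ G : ℝ → ℂ, ContDiff ℝ 4 G → (∀ t : ℝ, G t ≠ 0 → N ≤ t ∧ t ≤ 2 * N) →
        (∀ j : ℕ, j ≤ 4 → ∀ t : ℝ, ‖iteratedDeriv j G t‖ ≤ N ^ (-(j : ℝ))) →
        ‖∑ n ∈ (Finset.Icc 1 ⌊2 * N⌋₊).filter (fun n : ℕ => d ∣ n),
            polyRootWeylSum (DFI1995.quad a b c) n h * G n‖ ≤
          K * (Nat.divisors d).card * N ^ (1 / 2 : ℝ) *
            Real.sqrt (1 + (Nat.divisors (h * d)).card * (Nat.gcd h d : ℝ) ^ (1 / 2 : ℝ) / d *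
              N ^ (1 / 2 : ℝ)) * Real.log (2 * N) := by
  classical
  have hΔ : discrim a (2 * b) c < 0 := by rw [discrim_two_mul]; linarith
  have hsq : ¬ IsSquare (discrim a (2 * b) c) := fun ⟨r, hr⟩ => by nlinarith [hr]
  obtain ⟨Corb, hCorb⟩ := RootForms.exists_card_orbitReps_le (b := 2 * b) (c := c) ha hsq
  obtain ⟨C₀, hC₀, hcore⟩ := norm_sq_poincareFn_heegnerPt_le (b' := 2 * b) ha hΔ hC₂
  have ha' : (0 : ℝ) < a := by exact_mod_cast ha
  set AΔ : ℝ := |((discrim a (2 * b) c : ℤ) : ℝ)| with hAΔ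
  have hAΔ0 : 0 < AΔ := abs_pos.2 (by exact_mod_cast hΔ.ne)
  have hsA : 0 < Real.sqrt AΔ := Real.sqrt_pos.2 hAΔ0
  set κ : ℝ := Real.sqrt AΔ / (2 * a) with hκ
  have hκ0 : 0 < κ := by rw [hκ]; exact div_pos hsA (mul_pos two_pos ha')
  have h12κ : 0 < 1 + 2 / κ := by have := div_pos two_pos hκ0; linarith
  -- arithmetic constants
  set τa : ℝ := (a.toNat.divisors.card : ℝ) with hτa
  have hτa0 : 0 ≤ τa := Nat.cast_nonneg _
  set c₁ : ℝ := Real.sqrt (1 + 2 / κ) with hc₁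
  have hc₁0 : 0 ≤ c₁ := Real.sqrt_nonneg _
  set ℓ : ℝ := Real.log (1 + 2 / κ) with hℓ
  have hℓ0 : 0 ≤ ℓ := Real.log_nonneg (by linarith [div_pos two_pos hκ0])
  have hlog2 : 0 < Real.log 2 := Real.log_pos (by norm_num)
  set c₂ : ℝ := (1 + ℓ) / Real.log 2 + 1 with hc₂
  have hc₂0 : 0 ≤ c₂ := add_nonneg (div_nonneg (by linarith) hlog2.le) zero_le_one
  set c₃ : ℝ := Real.sqrt (a.toNat : ℝ) * τa with hc₃
  have hc₃0 : 0 ≤ c₃ := mul_nonneg (Real.sqrt_nonneg _) hτa0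
  set c₄ : ℝ := 1 / Real.log 2 + 256 * Real.sqrt 2 * c₁ * c₂ * c₃ with hc₄
  have h123 : 0 ≤ c₁ * c₂ * c₃ := mul_nonneg (mul_nonneg hc₁0 hc₂0) hc₃0
  have hc₄0 : 0 ≤ c₄ := by
    have : 0 ≤ 256 * Real.sqrt 2 * c₁ * c₂ * c₃ := by
      have := mul_nonneg (by positivity : (0 : ℝ) ≤ 256 * Real.sqrt 2) h123
      linarith [this]
    exact add_nonneg (by positivity) this
  refine ⟨2 * Corb * τa * Real.sqrt (C₀ * c₄) / Real.sqrt (Real.log 2), ?_⟩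
  intro h hh d hd N hN hhN G hG hG0 hGj
  have hN0 : 0 < N := by linarith
  have hNne : N ≠ 0 := hN0.ne'
  have hh0 : (0 : ℝ) < h := by exact_mod_cast hh
  set q : ℕ := a.toNat * d with hq
  have hatoNat : 1 ≤ a.toNat := by omega
  have hq0 : 0 < q := Nat.mul_pos (by omega) (by omega)
  set N' : ℕ := ⌊2 * N⌋₊ with hN'
  -- the kernel and the bound `M` at the Heegner points
  set βm : ℝ := ((2 * b : ℤ) : ℝ) / Real.sqrt AΔ with hβm
  set Φm : ℝ → ℂ := fun y : ℝ => G (κ / y) *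
    Complex.exp (2 * π * Complex.I * (-(βm * h) : ℝ) * (y : ℂ)) with hΦm
  set ψ : ℍ → ℂ := fun z : ℍ => Φm z.im *
    Complex.exp (2 * π * Complex.I * ((-(h : ℤ) : ℤ) : ℂ) * (z.re : ℂ)) with hψ
  set Wv : ℝ := 1 + 256 * Real.sqrt 2 *
    (Real.sqrt (Nat.gcd h (a.toNat * d)) * ((h * (a.toNat * d)).divisors.card : ℝ) / (a.toNat * d : ℕ) *
      Real.sqrt (max 1 (2 * N / κ)) * (1 + Real.log (max 1 (2 * N / κ)))) with hWv
  set M : ℝ := Real.sqrt (C₀ * N * Wv) with hM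
  have hMbd : ∀ (R : BinQF) (hA : 0 < R.a) (hRΔ : R.disc < 0),
      RootForms.IsLevelForm a (2 * b) (discrim a (2 * b) c) (a.toNat * d) R →
        ‖RootForms.poincareFn (a.toNat * d) ψ (RootForms.heegnerPt R hA hRΔ)‖ ≤ M := by
    intro R hA hRΔ hR
    have h2 := hcore h hh d hd N hN hhN G hG hG0 hGj R hA hRΔ hR
    have h3 := Real.abs_le_sqrt h2
    rwa [abs_of_nonneg (norm_nonneg _)] at h3
  -- T-invariance and the weight identity
  have hψT : ∀ z : ℍ, ψ (T • z) = ψ z := stripKernel_T_smul Φm (-(h : ℤ))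
  have hφ : ∀ (Q : BinQF) (hA : 0 < Q.a) (hQΔ : Q.disc < 0),
      RootForms.IsLevelForm a (2 * b) (discrim a (2 * b) c) (a.toNat * d) Q →
        ψ (RootForms.heegnerPt Q hA hQΔ) = RootForms.weylWeight a (2 * b) d N' h (fun n : ℕ => G n) Q :=
    fun Q hA hQΔ hQ => stripKernel_heegnerPt_eq_weylWeight ha G hG0 h hA hQΔ hQ
  have hS := RootForms.norm_weylSum_le_card_mul ha hΔ d N' (h : ℤ) (fun n : ℕ => G n) hψT hφ hMbd
  have hcard := hCorb d N' (by omega)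
  -- rewrite the sum of the statement
  have hsumeq : ∑ n ∈ (Finset.Icc 1 ⌊2 * N⌋₊).filter (fun n : ℕ => d ∣ n),
      polyRootWeylSum (DFI1995.quad a b c) n h * G n =
      ∑ n ∈ (Finset.Icc 1 N').filter (d ∣ ·),
        (fun n : ℕ => G n) n * polyRootWeylSum (C a * X ^ 2 + C (2 * b) * X + C c) n h :=
    Finset.sum_congr rfl fun n _ => by
      show _ = G n * _
      rw [quad_eq, mul_comm]
  rw [hsumeq]
  refine hS.trans ?_
  -- `M ≥ 0`, the count
  have hM0 : 0 ≤ M := Real.sqrt_nonneg _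
  have hcard' : (((RootForms.levelFormsUpTo a (2 * b) c d N').image
      (RootForms.orbitRep (a.toNat * d))).card : ℝ) ≤ Corb * (τa * (d.divisors.card : ℝ)) := by
    have h1 : (((RootForms.levelFormsUpTo a (2 * b) c d N').image
        (RootForms.orbitRep (a.toNat * d))).card : ℝ) ≤ Corb * ((a.toNat * d).divisors.card : ℝ) := by
      exact_mod_cast hcard
    refine h1.trans (mul_le_mul_of_nonneg_left ?_ (Nat.cast_nonneg _))
    have h2 := card_divisors_mul_le' a.toNat d
    rw [hτa]
    exact_mod_cast h2
  -- ### the arithmetic: `Wv ≤ c₄ (1 + u) log 2N`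
  set u : ℝ := ((h * d).divisors.card : ℝ) * Real.sqrt (Nat.gcd h d) / d * Real.sqrt N with hu
  have hu0 : 0 ≤ u := by rw [hu]; positivity
  have hlogN : 0 ≤ Real.log N := Real.log_nonneg hN
  have hlog2N : Real.log (2 * N) = Real.log 2 + Real.log N :=
    Real.log_mul (by norm_num) hN0.ne'
  have hlog2N0 : Real.log 2 ≤ Real.log (2 * N) := by rw [hlog2N]; linarith
  set Xr : ℝ := max 1 (2 * N / κ) with hXr
  have hX1 : 1 ≤ Xr := le_max_left _ _
  have hXle : Xr ≤ (1 + 2 / κ) * N := by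
    refine max_le ?_ ?_
    · have : (1 : ℝ) ≤ 1 + 2 / κ := by linarith [div_pos two_pos hκ0]
      nlinarith [this, hN]
    · rw [add_mul, div_mul_eq_mul_div]; linarith
  have hsqrtX : Real.sqrt Xr ≤ c₁ * Real.sqrt N := by
    rw [hc₁, ← Real.sqrt_mul h12κ.le]; exact Real.sqrt_le_sqrt hXle
  have hlogX : 1 + Real.log Xr ≤ c₂ * Real.log (2 * N) := by
    have h1 : Real.log Xr ≤ ℓ + Real.log N := by
      rw [hℓ, ← Real.log_mul h12κ.ne' hN0.ne']
      exact Real.log_le_log (lt_of_lt_of_le one_pos hX1) hXle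
    rw [hlog2N, hc₂]
    have h2 : 0 ≤ (1 + ℓ) / Real.log 2 * Real.log N := mul_nonneg (div_nonneg (by linarith) hlog2.le) hlogN
    have h3 : (1 + ℓ) / Real.log 2 * Real.log 2 = 1 + ℓ := by field_simp
    have h5 : ((1 + ℓ) / Real.log 2 + 1) * (Real.log 2 + Real.log N) =
        (1 + ℓ) / Real.log 2 * Real.log 2 + (1 + ℓ) / Real.log 2 * Real.log N + Real.log 2 + Real.log N := by
      ring
    rw [h5, h3]
    linarith [h1, h2, hlog2.le]
  obtain ⟨hgcd, hτhq⟩ := gcd_tau_level_le h a.toNat d (by omega) (by omega)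
  have hSq : Real.sqrt (Nat.gcd h (a.toNat * d)) * ((h * (a.toNat * d)).divisors.card : ℝ) / (a.toNat * d : ℕ) ≤
      c₃ * (((h * d).divisors.card : ℝ) * Real.sqrt (Nat.gcd h d) / d) := by
    have h1 : Real.sqrt (Nat.gcd h (a.toNat * d)) ≤ Real.sqrt (a.toNat : ℝ) * Real.sqrt (Nat.gcd h d) := by
      rw [← Real.sqrt_mul (Nat.cast_nonneg _)]; exact Real.sqrt_le_sqrt hgcd
    have h3 : (1 : ℝ) / (a.toNat * d : ℕ) ≤ 1 / d := by
      apply one_div_le_one_div_of_le (by exact_mod_cast hd)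
      have : (d : ℝ) ≤ (a.toNat : ℝ) * d := le_mul_of_one_le_left (Nat.cast_nonneg _) (by exact_mod_cast hatoNat)
      exact_mod_cast this
    rw [div_eq_mul_one_div]
    calc Real.sqrt (Nat.gcd h (a.toNat * d)) * ((h * (a.toNat * d)).divisors.card : ℝ) * (1 / (a.toNat * d : ℕ))
        ≤ (Real.sqrt (a.toNat : ℝ) * Real.sqrt (Nat.gcd h d)) * (τa * ((h * d).divisors.card : ℝ)) * (1 / d) := by
          apply mul_le_mul (mul_le_mul h1 hτhq (Nat.cast_nonneg _) (by positivity)) h3 (by positivity)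
            (mul_nonneg (by positivity) (mul_nonneg hτa0 (Nat.cast_nonneg _)))
      _ = c₃ * (((h * d).divisors.card : ℝ) * Real.sqrt (Nat.gcd h d) / d) := by rw [hc₃]; ring
  have hWv : Wv ≤ c₄ * (1 + u) * Real.log (2 * N) := by
    have h1 : Real.sqrt (Nat.gcd h (a.toNat * d)) * ((h * (a.toNat * d)).divisors.card : ℝ) / (a.toNat * d : ℕ) *
        Real.sqrt Xr * (1 + Real.log Xr) ≤
        (c₃ * (((h * d).divisors.card : ℝ) * Real.sqrt (Nat.gcd h d) / d)) * (c₁ * Real.sqrt N) *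
          (c₂ * Real.log (2 * N)) := by
      have hp : 0 ≤ 1 + Real.log Xr := by have := Real.log_nonneg hX1; linarith
      have hq1 : 0 ≤ c₃ * (((h * d).divisors.card : ℝ) * Real.sqrt (Nat.gcd h d) / d) :=
        mul_nonneg hc₃0 (by positivity)
      have hq2 : 0 ≤ c₃ * (((h * d).divisors.card : ℝ) * Real.sqrt (Nat.gcd h d) / d) * (c₁ * Real.sqrt N) :=
        mul_nonneg hq1 (mul_nonneg hc₁0 (Real.sqrt_nonneg _))
      apply mul_le_mul (mul_le_mul hSq hsqrtX (Real.sqrt_nonneg _) hq1) hlogX hp hq2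
    have h2 : (c₃ * (((h * d).divisors.card : ℝ) * Real.sqrt (Nat.gcd h d) / d)) * (c₁ * Real.sqrt N) *
        (c₂ * Real.log (2 * N)) = c₁ * c₂ * c₃ * u * Real.log (2 * N) := by rw [hu]; ring
    rw [hWv]
    have h4 : (1 : ℝ) ≤ 1 / Real.log 2 * Real.log (2 * N) := by
      rw [one_div, le_inv_mul_iff₀ hlog2]; simpa using hlog2N0
    have h5 : 0 ≤ c₁ * c₂ * c₃ := h123
    have h6 : 0 ≤ Real.log (2 * N) := hlog2.le.trans hlog2N0
    calc 1 + 256 * Real.sqrt 2 * (Real.sqrt (Nat.gcd h (a.toNat * d)) *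
          ((h * (a.toNat * d)).divisors.card : ℝ) / (a.toNat * d : ℕ) * Real.sqrt Xr * (1 + Real.log Xr))
        ≤ 1 / Real.log 2 * Real.log (2 * N) + 256 * Real.sqrt 2 * (c₁ * c₂ * c₃ * u * Real.log (2 * N)) := by
          rw [← h2]; gcongr
      _ ≤ c₄ * (1 + u) * Real.log (2 * N) := by
          rw [hc₄]
          have e1 := mul_nonneg (one_div_nonneg.2 hlog2.le) (mul_nonneg hu0 h6)
          have e2 := mul_nonneg (mul_nonneg (by positivity : (0 : ℝ) ≤ 256 * Real.sqrt 2) h5) h6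
          nlinarith [e1, e2]
  -- ### `M ≤ √(C₀ c₄) √N √(1 + u) log(2N) / √(log 2)`
  have hlog2N1 : 0 < Real.log (2 * N) := hlog2.trans_le hlog2N0
  have hMle : M ≤ Real.sqrt (C₀ * c₄) * Real.sqrt N * Real.sqrt (1 + u) *
      (Real.log (2 * N) / Real.sqrt (Real.log 2)) := by
    have h1 : C₀ * N * Wv ≤ (C₀ * c₄) * N * (1 + u) * Real.log (2 * N) := by
      have := mul_le_mul_of_nonneg_left hWv (mul_nonneg hC₀ hN0.le)
      linarith [this]
    have h2 : M ≤ Real.sqrt ((C₀ * c₄) * N * (1 + u) * Real.log (2 * N)) := Real.sqrt_le_sqrt h1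
    have hA0 : 0 ≤ C₀ * c₄ := mul_nonneg hC₀ hc₄0
    have hB0 : 0 ≤ C₀ * c₄ * N := mul_nonneg hA0 hN0.le
    have hC0' : 0 ≤ C₀ * c₄ * N * (1 + u) := mul_nonneg hB0 (by linarith)
    have h3 : Real.sqrt ((C₀ * c₄) * N * (1 + u) * Real.log (2 * N)) =
        Real.sqrt (C₀ * c₄) * Real.sqrt N * Real.sqrt (1 + u) * Real.sqrt (Real.log (2 * N)) := by
      rw [Real.sqrt_mul hC0', Real.sqrt_mul hB0, Real.sqrt_mul hA0]
    have h4 : Real.sqrt (Real.log (2 * N)) ≤ Real.log (2 * N) / Real.sqrt (Real.log 2) := by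
      rw [le_div_iff₀ (Real.sqrt_pos.2 hlog2)]
      calc Real.sqrt (Real.log (2 * N)) * Real.sqrt (Real.log 2)
          ≤ Real.sqrt (Real.log (2 * N)) * Real.sqrt (Real.log (2 * N)) :=
            mul_le_mul_of_nonneg_left (Real.sqrt_le_sqrt hlog2N0) (Real.sqrt_nonneg _)
        _ = Real.log (2 * N) := Real.mul_self_sqrt hlog2N1.le
    rw [h3] at h2
    exact h2.trans (mul_le_mul_of_nonneg_left h4 (by positivity))
  -- ### assemble
  have hτd0 : (0 : ℝ) ≤ (d.divisors.card : ℝ) := Nat.cast_nonneg _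
  have hfinal : 2 * (((RootForms.levelFormsUpTo a (2 * b) c d N').image
      (RootForms.orbitRep (a.toNat * d))).card : ℝ) * M ≤
      2 * Corb * τa * Real.sqrt (C₀ * c₄) / Real.sqrt (Real.log 2) * (d.divisors.card : ℝ) *
        Real.sqrt N * Real.sqrt (1 + u) * Real.log (2 * N) := by
    have hCt : 0 ≤ (Corb : ℝ) * (τa * (d.divisors.card : ℝ)) :=
      mul_nonneg (Nat.cast_nonneg _) (mul_nonneg hτa0 (Nat.cast_nonneg _))
    calc 2 * (((RootForms.levelFormsUpTo a (2 * b) c d N').image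
          (RootForms.orbitRep (a.toNat * d))).card : ℝ) * M
        ≤ 2 * (Corb * (τa * (d.divisors.card : ℝ))) * M :=
          mul_le_mul_of_nonneg_right (mul_le_mul_of_nonneg_left hcard' zero_le_two) hM0
      _ ≤ 2 * (Corb * (τa * (d.divisors.card : ℝ))) * (Real.sqrt (C₀ * c₄) * Real.sqrt N * Real.sqrt (1 + u) *
            (Real.log (2 * N) / Real.sqrt (Real.log 2))) :=
          mul_le_mul_of_nonneg_left hMle (mul_nonneg zero_le_two hCt)
      _ = _ := by ring
  refine hfinal.trans (le_of_eq ?_)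
  -- `√N = N^{1/2}`, `√(h,d) = (h,d)^{1/2}`
  rw [hu, Real.sqrt_eq_rpow N, Real.sqrt_eq_rpow (Nat.gcd h d : ℝ)]

end DFI1995

/-! ### The named fact -/

/-- **DFI 1995, Proposition 4** — discharge of the named fact
`dukeFriedlanderIwaniec1995_proposition4` (any sign of `a`: for `a < 0` replace `f` by `−f`,
which has the same roots). [cite: DukeFriedlanderIwaniec1995, Proposition 4 p. 432] -/
theorem dukeFriedlanderIwaniec1995_proposition4_holds : dukeFriedlanderIwaniec1995_proposition4 := by
  intro a b c hD C₂ hC₂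
  rcases lt_trichotomy a 0 with ha | ha | ha
  · -- `a < 0`: use `−f`
    have hD' : 0 < (-a) * (-c) - (-b) ^ 2 := by
      have e : (-a) * (-c) - (-b) ^ 2 = a * c - b ^ 2 := by ring
      rw [e]; exact hD
    obtain ⟨K, hK⟩ := DFI1995.proposition4_of_pos (a := -a) (b := -b) (c := -c) (by linarith) hD' hC₂
    refine ⟨K, fun h hh d hd N hN hhN G hG hG0 hGj => ?_⟩
    have := hK h hh d hd N hN hhN G hG hG0 hGj
    simpa only [DFI1995.quad_neg, polyRootWeylSum_neg_poly] using this
  · exfalso; rw [ha] at hD; nlinarith [sq_nonneg b]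
  · exact DFI1995.proposition4_of_pos ha hD hC₂


end Literature.NumberTheory.Sieve
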